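import Mathlib

/-!
HONEST FRAMING: exact (Metropolis-corrected) sampling algorithms for lattice gauge theory; figures of
merit are autocorrelation/cost numbers at stated couplings and volumes; no continuum-physics claim.

# PencilRadius — operator-level THEOREM M(iii) (THEORY-1.md §14.2): the radius of convergence of the
Neumann / Lüscher series of a linear pencil is EXACTLY the distance to its nearest singular point

Proposed tree path: `Summits/Ventures/LatticeQCDFlow/TrivializingMaps/PencilRadius.lean` (OURS — venture
work, never `Literature/`). Cell `lqcd-flow` (pub-lqcd), unit `pub-lqcd-theory1-g11`, 2026-08-21.
Companion of `FisherObstruction.lean` (THEOREM F: Fisher zeros are poles); this file is the other half of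
THEOREM M: poles, of whatever type, DETERMINE the radius.

## Setting and dictionary (THEORY-1 §14.1–14.2; Lüscher 2010 §4.2–4.3, eqs. (4.5)–(4.15))
Lüscher's flow action on a finite lattice solves the LINEAR PENCIL equation `(Δ + s Π𝓥) F_s = Π S₁`
(`s = tβ`), and his power series (4.11)–(4.15) is the Neumann series of that pencil:
`F_s = ∑ₖ sᵏ Tᵏ v₀`, `T = -Δ⁻¹Π𝓥`, `v₀ = Δ⁻¹ΠS₁`, i.e. the coefficients `aₖ = Tᵏ v₀` are defined by the
recursion `Δ a₀ = ΠS₁`, `Δ aₖ = -Π𝓥 aₖ₋₁`. Abstractly: in a complex Banach algebra `A` (bounded operators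
on `H = L²₀(Haar)` with `a = 1`, `b = -K`, `K = Δ^{-1/2}Π𝓥Δ^{-1/2}` the compact operator of THEOREM M(i);
or the Galerkin MATRIX pencils `a = Δ_N`, `b = -(Π𝓥)_N` actually diagonalised in THEORY-1 §14.5), one studies
the pencil `z ↦ a - z • b` with `a` invertible, `c := a⁻¹ b`, and the operator coefficients
`T n := cⁿ a⁻¹`, which satisfy Lüscher's recursion `a · T 0 = 1`, `a · T (n+1) = b · T n`
(`pencil_coeff_zero`, `pencil_coeff_succ`; uniqueness `pencil_coeff_unique`).

## What is here (Mathlib only; everything PROVED, 0 sorries, no new definitions)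
* `radius_le_of_not_isUnit` — "a pole is not a removable singularity", operator form: if `F` has a power
  series `q` at `0`, `u` is entire, `F · u = 1 = u · F` near `0`, and `u z₀` is NOT invertible, then
  `q.radius ≤ ‖z₀‖`.  (Identity theorem: the analytic continuation `q.sum` would invert `u z₀`.)
* `radius_geometric_eq_inv_spectralRadius` — for every element `c` of a (nontrivial) complex Banach
  algebra, the radius of convergence of the geometric series `∑ zⁿ cⁿ` (the Taylor series of
  `z ↦ (1 - z c)⁻¹` at `0`) is EXACTLY `(spectralRadius ℂ c)⁻¹`.  Mathlib has the lower bound inside the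
  proof of Gelfand's formula (`spectrum.differentiableOn_inverse_one_sub_smul`,
  `spectrum.hasFPowerSeriesOnBall_inverse_one_sub_smul`); the equality is proved here.
* the pencil dictionary: `units_mul_one_sub_smul` (`a (1 - z c) = a - z b`), `isUnit_pencil_iff`,
  `inverse_pencil_eq` (`(a - z b)⁻¹ = (1 - z c)⁻¹ a⁻¹`), `not_isUnit_pencil_iff` (for `z ≠ 0`:
  `a - z b` is singular iff `z⁻¹ ∈ σ(c)`), `isUnit_pencil_of_lt` (no singular point in the open disc of
  radius `(spectralRadius ℂ c)⁻¹`), `exists_not_isUnit_pencil` (a singular point ON that circle),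
  `hasSum_pencil` (`∑ zⁿ T n = (a - z b)⁻¹` for `‖z c‖ < 1`), `hasFPowerSeriesOnBall_pencil`
  (the series `∑ zⁿ T n` IS the Taylor series of the pencil resolvent at `0`).
* `pencil_radius_eq` — THEOREM M(iii), operator level: ANY power series of `z ↦ (a - z b)⁻¹` at `0` has
  radius EXACTLY `(spectralRadius ℂ (a⁻¹ b))⁻¹ = min {‖z‖ : a - z b singular}` (by the two previous items:
  no singular point inside, one on the circle).  Consequently Lüscher's operator series converges in the
  open disc up to the nearest singular point of the pencil `Σ = {s : Δ + sΠ𝓥 singular}` and in no larger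
  disc; THEOREM M(iv)–(v) (`FisherObstruction.lean`, `dichotomy_of_ibp`) classify the points of `Σ` as
  Fisher zeros or E-type points.
* `le_inv_spectralRadius_iff_isUnit_pencil`, `le_pencil_radius_iff` — the UNIFORM-RADIUS CRITERION of the
  §14.2 COROLLARY at operator level: the series converges on `‖z‖ < r` iff the pencil has no singular point
  there (so "radius `≥ r` uniformly in the volume" means "no volume has a singular pencil point in the disc").

What is NOT here: (1) the VECTOR series `∑ sᵏ Tᵏ v₀` applied to the particular `v₀ = Δ⁻¹ΠS₁` may have a
LARGER radius (`dist(0,P)`, `P ⊆ Σ` the "visible" poles, THEOREM M(iii)/(vi)); only `radius ≥ dist(0,Σ)`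
transfers verbatim, and the symmetry selection rule is not formalised; (2) the lattice objects (`Δ`, `𝓥`,
Haar measure, compactness of `K`) — the dictionary is discharged on paper in THEORY-1 §14.2 and, for U(1)
in Fourier space, in `AbelianDictionary.lean`; (3) nothing about the infinite-volume limit (THEOREM A,
`AbelianRadius.lean`, gives the volume-uniform lower bound for U(1)).

References: M. Lüscher, Commun. Math. Phys. 293 (2010) 899 [arXiv:0907.5491], §4.2–4.3, App. E (bib
`Luscher2010Trivializing`); THEORY-1.md §14 (THEOREM M), §20.5; T. Kato, Perturbation Theory for Linear
Operators (Springer 1966), Ch. I §4.4, Example 4.9 ("the convergence radius of `∑ tⁿ Tⁿ = (1 - tT)⁻¹` is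
exactly `1/spr T`") and §5.2 (eq. (5.12) and the footnote "a removable singularity of the resolvent is a
regular point") (bib `Kato1966`; held copy `book:kato1966-perturbation-theory-linear-operators`, PDF pp. 65–66,
71) — the classical operator-theory statements of which `radius_geometric_eq_inv_spectralRadius` and
`radius_le_of_not_isUnit` are the Banach-algebra, kernel-checked form.
-/

open scoped NNReal ENNReal Topology
open Filter

namespace Summit.Ventures.LatticeQCDFlow.TrivializingMaps.Pencil

/-! ## 1. Algebra of the pencil `a - z • b` with `a` invertible (Lüscher's `Δ + sΠ𝓥`) -/

section Algebra

variable {A : Type*} [Ring A] (a : Aˣ) (b : A)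

/-- `Ring.inverse (a x) = Ring.inverse x · a⁻¹` for a unit `a` (both sides vanish when `x` is singular). -/
theorem inverse_units_mul (x : A) : Ring.inverse ((a : A) * x) = Ring.inverse x * ↑a⁻¹ := by
  by_cases hx : IsUnit x
  · obtain ⟨w, rfl⟩ := hx
    rw [← Units.val_mul, Ring.inverse_unit, Ring.inverse_unit, mul_inv_rev, Units.val_mul]
  · rw [Ring.inverse_non_unit _ hx, zero_mul, Ring.inverse_non_unit]
    rwa [Units.isUnit_units_mul]

/-- Lüscher's recursion, step `0`: `a · T 0 = 1` for `T n = (a⁻¹b)ⁿ a⁻¹` (i.e. `Δ a₀ = ΠS₁` after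
applying to `ΠS₁`). -/
theorem pencil_coeff_zero : (a : A) * (((↑a⁻¹ : A) * b) ^ 0 * ↑a⁻¹) = 1 := by
  simp

/-- Lüscher's recursion (Lüscher 2010, (4.14)–(4.15); THEORY-1 §14.1 `aₖ = T aₖ₋₁`): the operator
coefficients `T n = (a⁻¹b)ⁿ a⁻¹` satisfy `a · T (n+1) = b · T n` (with `b = -Π𝓥`: `Δ aₖ = -Π𝓥 aₖ₋₁`). -/
theorem pencil_coeff_succ (n : ℕ) :
    (a : A) * (((↑a⁻¹ : A) * b) ^ (n + 1) * ↑a⁻¹) = b * (((↑a⁻¹ : A) * b) ^ n * ↑a⁻¹) := by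
  simp only [pow_succ', mul_assoc, Units.mul_inv_cancel_left]

/-- Uniqueness of the recursion: any operator sequence with `a · T 0 = 1`, `a · T (n+1) = b · T n` is
`T n = (a⁻¹b)ⁿ a⁻¹`. -/
theorem pencil_coeff_unique (T : ℕ → A) (h0 : (a : A) * T 0 = 1)
    (hsucc : ∀ n, (a : A) * T (n + 1) = b * T n) (n : ℕ) :
    T n = ((↑a⁻¹ : A) * b) ^ n * ↑a⁻¹ := by
  induction n with
  | zero =>
    calc T 0 = (↑a⁻¹ : A) * ((a : A) * T 0) := by rw [Units.inv_mul_cancel_left]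
      _ = ((↑a⁻¹ : A) * b) ^ 0 * ↑a⁻¹ := by rw [h0, mul_one, pow_zero, one_mul]
  | succ n ih =>
    have h := hsucc n
    rw [ih] at h
    calc T (n + 1) = (↑a⁻¹ : A) * ((a : A) * T (n + 1)) := by rw [Units.inv_mul_cancel_left]
      _ = (↑a⁻¹ : A) * (b * (((↑a⁻¹ : A) * b) ^ n * ↑a⁻¹)) := by rw [h]
      _ = ((↑a⁻¹ : A) * b) ^ (n + 1) * ↑a⁻¹ := by simp only [pow_succ', mul_assoc]

variable [Algebra ℂ A]

/-- `a (1 - z a⁻¹b) = a - z b`. -/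
theorem units_mul_one_sub_smul (z : ℂ) :
    (a : A) * (1 - z • ((↑a⁻¹ : A) * b)) = a - z • b := by
  rw [mul_sub, mul_one, mul_smul_comm, ← mul_assoc, Units.mul_inv, one_mul]

/-- The pencil point `a - z b` is invertible iff `1 - z (a⁻¹ b)` is. -/
theorem isUnit_pencil_iff (z : ℂ) :
    IsUnit ((a : A) - z • b) ↔ IsUnit (1 - z • ((↑a⁻¹ : A) * b)) := by
  rw [← units_mul_one_sub_smul a b z, Units.isUnit_units_mul]

/-- The pencil resolvent factors through the Neumann resolvent: `(a - z b)⁻¹ = (1 - z a⁻¹b)⁻¹ a⁻¹`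
(as `Ring.inverse`, i.e. `0` at singular points on both sides). -/
theorem inverse_pencil_eq (z : ℂ) :
    Ring.inverse ((a : A) - z • b) = Ring.inverse (1 - z • ((↑a⁻¹ : A) * b)) * ↑a⁻¹ := by
  rw [← units_mul_one_sub_smul a b z, inverse_units_mul]

/-- The singular set of the pencil: for `z ≠ 0`, `a - z b` is NOT invertible iff `z⁻¹ ∈ σ(a⁻¹b)`
(THEORY-1 §14.2(i): `Σ = {s ≠ 0 : -1/s ∈ σ(K)}` with `b = -K`). -/
theorem not_isUnit_pencil_iff {z : ℂ} (hz : z ≠ 0) :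
    ¬ IsUnit ((a : A) - z • b) ↔ z⁻¹ ∈ spectrum ℂ ((↑a⁻¹ : A) * b) := by
  rw [isUnit_pencil_iff, spectrum.mem_iff, Algebra.algebraMap_eq_smul_one]
  have key := IsUnit.smul_sub_iff_sub_inv_smul (Units.mk0 z⁻¹ (inv_ne_zero hz)) ((↑a⁻¹ : A) * b)
  rw [Units.smul_def, Units.smul_def, Units.val_inv_eq_inv_val, Units.val_mk0, inv_inv] at key
  rw [key]

end Algebra

/-! ## 2. A singular point of the pencil bounds the radius of convergence -/

section Analytic

variable {A : Type*} [NormedRing A] [NormedAlgebra ℂ A] [CompleteSpace A]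

/-- **A pole is not a removable singularity (operator form).**  Let `F : ℂ → A` have the power series `q`
at `0`, let `u : ℂ → A` be entire, and suppose `F z * u z = 1` and `u z * F z = 1` for `z` near `0`
(e.g. `F z = Ring.inverse (u z)` with `u 0` invertible).  If `u z₀` is not invertible, then the radius of
convergence of `q` is at most `‖z₀‖`: otherwise the sum of `q` would be an analytic continuation of `F` to a
disc containing `z₀`, on which `q.sum * u = 1 = u * q.sum` by the identity theorem, inverting `u z₀`. -/
theorem radius_le_of_not_isUnit {F u : ℂ → A} {q : FormalMultilinearSeries ℂ ℂ A}
    (hF : HasFPowerSeriesAt F q 0) (hu : AnalyticOnNhd ℂ u Set.univ)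
    (hFu : ∀ᶠ z in 𝓝 (0 : ℂ), F z * u z = 1 ∧ u z * F z = 1)
    {z₀ : ℂ} (hz₀ : ¬ IsUnit (u z₀)) : q.radius ≤ ‖z₀‖₊ := by
  by_contra hlt
  rw [not_le] at hlt
  obtain ⟨r, hz₀r, hrq⟩ := ENNReal.lt_iff_exists_nnreal_btwn.1 hlt
  have hq_pos : 0 < q.radius := lt_of_le_of_lt bot_le hlt
  have hg : HasFPowerSeriesOnBall q.sum q 0 q.radius := q.hasFPowerSeriesOnBall hq_pos
  -- `F` agrees with `q.sum` near `0`
  obtain ⟨r₀, hr₀⟩ := hF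
  have hFg : ∀ᶠ z in 𝓝 (0 : ℂ), F z = q.sum z := by
    filter_upwards [Metric.eball_mem_nhds (0 : ℂ) hr₀.r_pos] with z hz
    simpa using hr₀.sum hz
  -- the disc of radius `r` is preconnected, contains `0` and `z₀`, and lies inside the disc of convergence
  have hz₀r' : ‖z₀‖ < r := by
    have h := ENNReal.coe_lt_coe.1 hz₀r
    exact_mod_cast h
  have hr_pos : (0 : ℝ) < r := lt_of_le_of_lt (norm_nonneg _) hz₀r'
  set U : Set ℂ := Metric.ball (0 : ℂ) r with hU
  have hUconn : IsPreconnected U := (convex_ball (0 : ℂ) (r : ℝ)).isPreconnected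
  have h0U : (0 : ℂ) ∈ U := Metric.mem_ball_self hr_pos
  have hz₀U : z₀ ∈ U := mem_ball_zero_iff.2 hz₀r'
  have hUsub : U ⊆ Metric.eball (0 : ℂ) q.radius := by
    intro z hz
    rw [mem_ball_zero_iff] at hz
    rw [mem_eball_zero_iff]
    have hz' : (‖z‖₊ : ℝ≥0∞) < r := by
      have : ‖z‖₊ < r := by
        rw [← NNReal.coe_lt_coe, coe_nnnorm]
        exact hz
      exact ENNReal.coe_lt_coe.2 this
    exact hz'.trans hrq
  have hgan : AnalyticOnNhd ℂ q.sum U := fun z hz => hg.analyticAt_of_mem (hUsub hz)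
  have huan : AnalyticOnNhd ℂ u U := fun z _ => hu z (Set.mem_univ z)
  -- identity theorem, twice
  have h1 : Set.EqOn (fun z => q.sum z * u z) (fun _ => (1 : A)) U := by
    refine (hgan.mul huan).eqOn_of_preconnected_of_eventuallyEq analyticOnNhd_const hUconn h0U ?_
    filter_upwards [hFg, hFu] with z h h'
    simp only [← h]
    exact h'.1
  have h2 : Set.EqOn (fun z => u z * q.sum z) (fun _ => (1 : A)) U := by
    refine (huan.mul hgan).eqOn_of_preconnected_of_eventuallyEq analyticOnNhd_const hUconn h0U ?_
    filter_upwards [hFg, hFu] with z h h'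
    simp only [← h]
    exact h'.2
  have e1 : q.sum z₀ * u z₀ = 1 := h1 hz₀U
  have e2 : u z₀ * q.sum z₀ = 1 := h2 hz₀U
  exact hz₀ ⟨⟨u z₀, q.sum z₀, e2, e1⟩, rfl⟩

/-! ## 3. The exact radius of the geometric series `∑ zⁿ cⁿ` -/

/-- For `z` near `0`, `1 - z • c` is invertible and `Ring.inverse (1 - z • c)` is a two-sided inverse. -/
theorem eventually_inverse_one_sub_smul_mul (c : A) :
    ∀ᶠ z in 𝓝 (0 : ℂ), Ring.inverse (1 - z • c) * (1 - z • c) = 1 ∧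
      (1 - z • c) * Ring.inverse (1 - z • c) = 1 := by
  have hcont : ContinuousAt (fun z : ℂ => (1 : A) - z • c) 0 := by fun_prop
  have hmem : {x : A | IsUnit x} ∈ 𝓝 ((fun z : ℂ => (1 : A) - z • c) 0) :=
    Units.isOpen.mem_nhds (by simp)
  filter_upwards [hcont.preimage_mem_nhds hmem] with z hz
  exact ⟨Ring.inverse_mul_cancel _ hz, Ring.mul_inverse_cancel _ hz⟩

/-- A spectral value of maximal modulus yields a NON-invertible `1 - z₀ • c` with
`‖z₀‖ = (spectralRadius ℂ c)⁻¹` (when the spectral radius is non-zero). -/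
theorem exists_not_isUnit_one_sub_smul [Nontrivial A] (c : A) (hρ : spectralRadius ℂ c ≠ 0) :
    ∃ z₀ : ℂ, (‖z₀‖₊ : ℝ≥0∞) = (spectralRadius ℂ c)⁻¹ ∧ ¬ IsUnit (1 - z₀ • c) := by
  obtain ⟨k, hk, hkρ⟩ :=
    spectrum.exists_nnnorm_eq_spectralRadius_of_nonempty (spectrum.nonempty c)
  have hk0 : k ≠ 0 := by
    rintro rfl
    apply hρ
    rw [← hkρ]
    simp
  refine ⟨k⁻¹, ?_, ?_⟩
  · rw [nnnorm_inv, ENNReal.coe_inv (by simpa using hk0), hkρ]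
  · have key := IsUnit.smul_sub_iff_sub_inv_smul (Units.mk0 k hk0) c
    rw [Units.smul_def, Units.smul_def, Units.val_inv_eq_inv_val, Units.val_mk0] at key
    rw [spectrum.mem_iff, Algebra.algebraMap_eq_smul_one, key] at hk
    exact hk

/-- **Exact radius of the geometric (Neumann) series.**  In a nontrivial complex Banach algebra the
radius of convergence of `∑ₙ zⁿ cⁿ` — the Taylor series at `0` of `z ↦ (1 - z c)⁻¹`
(`spectrum.hasFPowerSeriesOnBall_inverse_one_sub_smul`) — equals `(spectralRadius ℂ c)⁻¹` EXACTLY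
(`= ⊤` when `c` is quasi-nilpotent).  Lower bound: Mathlib's Gelfand-formula argument; upper bound:
`radius_le_of_not_isUnit` at a spectral value of maximal modulus. -/
theorem radius_geometric_eq_inv_spectralRadius [Nontrivial A] (c : A) :
    FormalMultilinearSeries.radius
      (fun n => ContinuousMultilinearMap.mkPiRing ℂ (Fin n) (c ^ n) : FormalMultilinearSeries ℂ ℂ A)
      = (spectralRadius ℂ c)⁻¹ := by
  set p : FormalMultilinearSeries ℂ ℂ A := fun n => ContinuousMultilinearMap.mkPiRing ℂ (Fin n) (c ^ n)
    with hp
  have H0 : HasFPowerSeriesOnBall (fun z : ℂ => Ring.inverse (1 - z • c)) p 0 ‖c‖₊⁻¹ :=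
    spectrum.hasFPowerSeriesOnBall_inverse_one_sub_smul ℂ c
  apply le_antisymm
  · by_cases hρ : spectralRadius ℂ c = 0
    · simp [hρ]
    obtain ⟨z₀, hz₀, hnu⟩ := exists_not_isUnit_one_sub_smul c hρ
    rw [← hz₀]
    have hu : AnalyticOnNhd ℂ (fun z : ℂ => (1 : A) - z • c) Set.univ := fun z _ => by fun_prop
    exact radius_le_of_not_isUnit H0.hasFPowerSeriesAt hu (eventually_inverse_one_sub_smul_mul c) hnu
  · refine ENNReal.le_of_forall_pos_nnreal_lt fun r r_pos r_lt => ?_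
    exact (H0.exchange_radius
      ((spectrum.differentiableOn_inverse_one_sub_smul r_lt).hasFPowerSeriesOnBall r_pos)).r_le

/-! ## 4. The pencil: no singular point inside, one on the circle, and the exact radius -/

variable (a : Aˣ) (b : A)

omit [CompleteSpace A] in
/-- No singular point of the pencil in the open disc `‖z‖ < (spectralRadius ℂ (a⁻¹b))⁻¹`. -/
theorem isUnit_pencil_of_lt {z : ℂ}
    (h : (‖z‖₊ : ℝ≥0∞) < (spectralRadius ℂ ((↑a⁻¹ : A) * b))⁻¹) : IsUnit ((a : A) - z • b) :=
  (isUnit_pencil_iff a b z).2 (spectrum.isUnit_one_sub_smul_of_lt_inv_radius h)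

/-- A singular point of the pencil ON the circle `‖z‖ = (spectralRadius ℂ (a⁻¹b))⁻¹` (nontrivial algebra,
non-zero spectral radius; if the spectral radius is `0` the pencil has no singular point at all). -/
theorem exists_not_isUnit_pencil [Nontrivial A] (hρ : spectralRadius ℂ ((↑a⁻¹ : A) * b) ≠ 0) :
    ∃ z₀ : ℂ, (‖z₀‖₊ : ℝ≥0∞) = (spectralRadius ℂ ((↑a⁻¹ : A) * b))⁻¹ ∧ ¬ IsUnit ((a : A) - z₀ • b) := by
  obtain ⟨z₀, hz₀, hnu⟩ := exists_not_isUnit_one_sub_smul ((↑a⁻¹ : A) * b) hρ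
  exact ⟨z₀, hz₀, fun h => hnu ((isUnit_pencil_iff a b z₀).1 h)⟩

/-- For `z` near `0` the pencil resolvent is a two-sided inverse of `a - z b`. -/
theorem eventually_inverse_pencil_mul :
    ∀ᶠ z in 𝓝 (0 : ℂ), Ring.inverse ((a : A) - z • b) * ((a : A) - z • b) = 1 ∧
      ((a : A) - z • b) * Ring.inverse ((a : A) - z • b) = 1 := by
  have hcont : ContinuousAt (fun z : ℂ => (a : A) - z • b) 0 := by fun_prop
  have hmem : {x : A | IsUnit x} ∈ 𝓝 ((fun z : ℂ => (a : A) - z • b) 0) :=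
    Units.isOpen.mem_nhds (by simp)
  filter_upwards [hcont.preimage_mem_nhds hmem] with z hz
  exact ⟨Ring.inverse_mul_cancel _ hz, Ring.mul_inverse_cancel _ hz⟩

/-- **Lüscher's series sums to the pencil resolvent** near `0`: for `‖z (a⁻¹b)‖ < 1`,
`∑ₙ zⁿ (a⁻¹b)ⁿ a⁻¹ = (a - z b)⁻¹` (Neumann series; Lüscher 2010 App. E gives the corresponding crude
lower bound on the radius). -/
theorem hasSum_pencil {z : ℂ} (hz : ‖z • ((↑a⁻¹ : A) * b)‖ < 1) :
    HasSum (fun n : ℕ => z ^ n • (((↑a⁻¹ : A) * b) ^ n * ↑a⁻¹)) (Ring.inverse ((a : A) - z • b)) := by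
  rw [inverse_pencil_eq]
  refine ((hasSum_geom_series_inverse _ hz).mul_right (↑a⁻¹ : A)).congr_fun fun n => ?_
  rw [smul_pow, smul_mul_assoc]

/-- The series `∑ₙ zⁿ (a⁻¹b)ⁿ a⁻¹` IS the Taylor series at `0` of the pencil resolvent `z ↦ (a - z b)⁻¹`,
valid on the ball of radius `‖a⁻¹b‖⁻¹`. -/
theorem hasFPowerSeriesOnBall_pencil :
    HasFPowerSeriesOnBall (fun z : ℂ => Ring.inverse ((a : A) - z • b))
      (fun n => ContinuousMultilinearMap.mkPiRing ℂ (Fin n) (((↑a⁻¹ : A) * b) ^ n * ↑a⁻¹))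
      0 ‖(↑a⁻¹ : A) * b‖₊⁻¹ := by
  set c : A := (↑a⁻¹ : A) * b with hc
  set L : A →L[ℂ] A := (ContinuousLinearMap.mul ℂ A).flip (↑a⁻¹ : A) with hL
  have H1 := L.comp_hasFPowerSeriesOnBall (spectrum.hasFPowerSeriesOnBall_inverse_one_sub_smul ℂ c)
  have hfun : (⇑L ∘ fun z : ℂ => Ring.inverse (1 - z • c)) =
      fun z : ℂ => Ring.inverse ((a : A) - z • b) := by
    funext z
    simp only [Function.comp_apply, hL, ContinuousLinearMap.flip_apply,
      ContinuousLinearMap.mul_apply', inverse_pencil_eq a b z, hc]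
  have hser : L.compFormalMultilinearSeries
        (fun n => ContinuousMultilinearMap.mkPiRing ℂ (Fin n) (c ^ n)) =
      (fun n => ContinuousMultilinearMap.mkPiRing ℂ (Fin n) (c ^ n * ↑a⁻¹) :
        FormalMultilinearSeries ℂ ℂ A) := by
    funext n
    ext
    simp [hL, ContinuousMultilinearMap.mkPiRing_apply]
  rw [hfun, hser] at H1
  exact H1

/-- **THEOREM M(iii), operator level** (THEORY-1 §14.2): ANY power series of the pencil resolvent
`z ↦ (a - z b)⁻¹` at `0` — in particular Lüscher's `∑ zⁿ T n` (`hasFPowerSeriesOnBall_pencil`) — has radius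
of convergence EXACTLY `(spectralRadius ℂ (a⁻¹b))⁻¹`, which by `isUnit_pencil_of_lt` /
`exists_not_isUnit_pencil` is the modulus of the NEAREST SINGULAR POINT of the pencil: the series converges
on the open disc free of singular points and on no larger disc. -/
theorem pencil_radius_eq [Nontrivial A] {q : FormalMultilinearSeries ℂ ℂ A}
    (hq : HasFPowerSeriesAt (fun z : ℂ => Ring.inverse ((a : A) - z • b)) q 0) :
    q.radius = (spectralRadius ℂ ((↑a⁻¹ : A) * b))⁻¹ := by
  apply le_antisymm
  · by_cases hρ : spectralRadius ℂ ((↑a⁻¹ : A) * b) = 0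
    · simp [hρ]
    obtain ⟨z₀, hz₀, hnu⟩ := exists_not_isUnit_pencil a b hρ
    rw [← hz₀]
    have hu : AnalyticOnNhd ℂ (fun z : ℂ => (a : A) - z • b) Set.univ := fun z _ => by fun_prop
    exact radius_le_of_not_isUnit hq hu (eventually_inverse_pencil_mul a b) hnu
  · refine ENNReal.le_of_forall_pos_nnreal_lt fun r r_pos r_lt => ?_
    obtain ⟨r₀, h₀⟩ := hq
    have hd : DifferentiableOn ℂ (fun z : ℂ => Ring.inverse ((a : A) - z • b))
        (Metric.closedBall 0 r) := by
      have h1 := (spectrum.differentiableOn_inverse_one_sub_smul r_lt).mul_const (↑a⁻¹ : A)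
      exact h1.congr fun z _ => inverse_pencil_eq a b z
    exact (h₀.exchange_radius (hd.hasFPowerSeriesOnBall r_pos)).r_le

/-- The radius of Lüscher's explicit series `∑ zⁿ (a⁻¹b)ⁿ a⁻¹` is `(spectralRadius ℂ (a⁻¹b))⁻¹`. -/
theorem luscher_series_radius_eq [Nontrivial A] :
    FormalMultilinearSeries.radius
      (fun n => ContinuousMultilinearMap.mkPiRing ℂ (Fin n) (((↑a⁻¹ : A) * b) ^ n * ↑a⁻¹) :
        FormalMultilinearSeries ℂ ℂ A)
      = (spectralRadius ℂ ((↑a⁻¹ : A) * b))⁻¹ :=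
  pencil_radius_eq a b (hasFPowerSeriesOnBall_pencil a b).hasFPowerSeriesAt

/-- **Uniform-radius criterion** (the form used by the COROLLARY of THEORY-1 §14.2 — "`inf_V R₀(V) ≥ r`
iff no volume `V` has a singular pencil point in `|s| < r`", i.e. what Lüscher's "`𝓛⁻¹` bounded in a
complex neighbourhood of `t = 0`, uniformly in the volume" amounts to at operator level):
`r ≤ (spectralRadius ℂ (a⁻¹b))⁻¹` iff the pencil `a - z b` has NO singular point in the open disc
`‖z‖ < r`. -/
theorem le_inv_spectralRadius_iff_isUnit_pencil [Nontrivial A] {r : ℝ≥0∞} :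
    r ≤ (spectralRadius ℂ ((↑a⁻¹ : A) * b))⁻¹ ↔
      ∀ z : ℂ, (‖z‖₊ : ℝ≥0∞) < r → IsUnit ((a : A) - z • b) := by
  constructor
  · intro hr z hz
    exact isUnit_pencil_of_lt a b (hz.trans_le hr)
  · intro h
    by_contra hlt
    rw [not_le] at hlt
    have hρ : spectralRadius ℂ ((↑a⁻¹ : A) * b) ≠ 0 := by
      intro h0
      rw [h0, ENNReal.inv_zero] at hlt
      exact not_top_lt hlt
    obtain ⟨z₀, hz₀, hnu⟩ := exists_not_isUnit_pencil a b hρ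
    have hz₀r : (‖z₀‖₊ : ℝ≥0∞) < r := by
      rw [hz₀]
      exact hlt
    exact hnu (h z₀ hz₀r)

/-- The same criterion for the radius of convergence of ANY power series `q` of the pencil resolvent at
`0` (e.g. Lüscher's series): `q` converges on the disc `‖z‖ < r` (`r ≤ q.radius`) iff `a - z b` is
invertible for every `‖z‖ < r`. -/
theorem le_pencil_radius_iff [Nontrivial A] {q : FormalMultilinearSeries ℂ ℂ A}
    (hq : HasFPowerSeriesAt (fun z : ℂ => Ring.inverse ((a : A) - z • b)) q 0) {r : ℝ≥0∞} :
    r ≤ q.radius ↔ ∀ z : ℂ, (‖z‖₊ : ℝ≥0∞) < r → IsUnit ((a : A) - z • b) := by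
  rw [pencil_radius_eq a b hq]
  exact le_inv_spectralRadius_iff_isUnit_pencil a b

end Analytic

end Summit.Ventures.LatticeQCDFlow.TrivializingMaps.Pencil
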